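import Summits.ResolutionOfSingularities.ResolutionOfSingularities.Theorems.FrobeniusClosingPatchingRelPerfectTwoQuadricMemberTower
import Summits.ResolutionOfSingularities.ResolutionOfSingularities.Theorems.FrobeniusClosingPatchingRelPerfectTwoQuadricMemberAlgebra
import HarnessLib

/-!
# Crux `PatchingRelPerfect` (stmt-ResolutionOfSingularities-16161), chain W5.2 — the TWO-QUADRIC
# member `I = (x₀x₁ − x₂², x₃²) + 𝔪⁴`, part 3: the member is in the companion class `𝒞`

[OURS · L1 W5.2 · kernel certificate, res-L1-w52-plan-1 NAMING G11-3 (1) 2026-08-27T15:05:28Z]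
The FIRST MULTI-FORM depth-two graded member whose forms ideal sheaf on `E ≅ ℙ³` is NOT locally
principal (two quadrics without common factor, `d = 2`, `s = 2`; CHAIN v2.9 §3 «not yet covered»):
`I = (x₀x₁ − x₂², x₃²) + 𝔪⁴` in a regular local ring `S` with regular system of parameters
`x₀, x₁, x₂, x₃` (every characteristic, every residue field).  Hand tower: `Bl_𝔪`, on which
`I𝒪 = 𝓘_E² · K`, `K = (ṽ) + (p̃²) + (𝓘_E²)` (`ṽ` the de-homogenised quadric, `p̃ = x₃/x_i`), of order
`≤ 1` along its cosupport, the CONIC `C₁ = {x₃ = 0, x₀x₁ = x₂²} ⊂ E`; `Bl_{C₁}` (avatar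
`P₁ = (q) + x₃𝔪 + 𝔪³`); then the SURFACE `C₂ = V(ṽ′) ∩ F₁` (avatar `P₂ = q𝔪 + x₃²𝔪 + x₃𝔪³ + 𝔪⁵`,
residual `J = (ṽ) + 𝓘_{C₁}²`); then `K″ = (1)`.  PROVED:

* `TwoQuadric.map_member_mul_Q₀` (with `CuspMember.map_M_pow`) — on every Rees chart `B_i` of `Bl_𝔪`:
  `(I · P₁ · P₂) B_i = u⁷ · ((K · J) · P)` with `P = (u, e₃, w)`, `w = e₀e₁ − e₂²`
  (`e_j = x_j/x_i`, `e_i = 1`);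
* `TwoQuadric.isRegular_charts` — every blowing up of every chart along that ideal is regular:
  `i = 3`: `e₃ = 1`, the residual is `(1)`; `i = 0, 1, 2`: the conic tower of part 1
  (`conicTower_isRegular`) with the quasi-regularity / regular-quotient inputs of part 2
  (`hyps_gen_sub_gen_sq` for `w = e₁ − e₂²`, `e₀ − e₂²`; `hyps_gen_mul_gen_sub_one` for
  `w = e₀e₁ − 1`, the hyperbola chart);
* `TwoQuadric.companion_member` (`Q = P₁P₂𝔪 ⊇ 𝔪⁹`), `TwoQuadric.coreRung_member`,
  `coreRung_member_of_ringKrullDim`, `atomDimFourBlowupAt_member` — `I ∈ 𝒞`, the conclusion of the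
  blow-up-form open core for every `T = Bl_I Spec S`, in the registered binder shape
  (`atomConclusion_of_pointBlowup_charts`, `N = 8`).

(β-AX) record (plan-1 G11-3; `MultiHostState` terms): member family `𝓔 = [E]`, host
`(𝓐₁, ℬ₁) = ((ṽ), [])`, N-summand `mono[(P̃₃, 2)] ⊔ mono[(E, 2)]`; step 1: `W = C₁` (curve component of
`cosupp K`, `m₁ = 1`, `ν = 1`) ↦ `K′ = (ṽ′) ⊔ mono[(F₁, 1)]`; step 2: `W = C₂ = V(ṽ′) ∩ F₁` (surface
component, `m = 1`, `ν = 1`) ↦ `K″ = (1)`, END; no E-side (order `≤ 1` from the start).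
Fact-free; nothing here is a statement of the manuscript under review (AI-written; AI review weaker
than expert review).

## References

* Q. Liu, *Algebraic Geometry and Arithmetic Curves*, OUP 2002, Thm. 8.1.19 (a). [Liu2002]
* The Stacks Project, Tags 080A, 080B, 0804, 0BIQ. [StacksProject]
* U. Görtz, T. Wedhorn, *Algebraic Geometry I* (2nd ed., 2020), Prop. 13.91 (2). [GortzWedhorn2020]
-/

-- `Summit.<Summit>.<Sub>.Theorems` with `Sub = Summit` (single-conjunct summit, D-0017)
set_option linter.dupNamespace false

noncomputable section

open CategoryTheory CategoryTheory.Limits AlgebraicGeometry Literature.AlgebraicGeometry.Resolution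
open scoped Pointwise nonZeroDivisors

namespace Summit.ResolutionOfSingularities.ResolutionOfSingularities.Theorems

universe u

namespace TwoQuadric

open CuspMember

/-! ## Generic identities (plain instance path) -/

section Algebra

variable {A : Type u} [CommRing A]

/-- `1 · a = a` over `CommRing` (plain instance path, cf. `mul_one_cr`). [folklore] -/
theorem one_mul_cr (a : A) : 1 * a = a := one_mul a

/-- `1² = 1` over `CommRing` (plain instance path). [folklore] -/
theorem one_sq_cr : (1 : A) ^ 2 = 1 := one_pow 2

/-- **Chart of `x₃`** (`e₃ = 1`): the residual `(K · J) · P` is the unit ideal. [folklore] -/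
theorem residual_top (u w : A) :
    (Ideal.span {w} ⊔ Ideal.span {(1 : A) ^ 2} ⊔ Ideal.span {u ^ 2}) *
      (Ideal.span {w} ⊔ Ideal.span {(1 : A) ^ 2} ⊔ Ideal.span {u * 1} ⊔ Ideal.span {u ^ 2}) *
      (Ideal.span {u} ⊔ Ideal.span {(1 : A)} ⊔ Ideal.span {w}) = ⊤ := by
  simp only [one_pow, Ideal.span_singleton_one, sup_top_eq, top_sup_eq, Ideal.top_mul]

/-- Collecting the Cartier twist: `(u²K)(u²P · u³J) = u⁷ · ((K J) P)`. [folklore] -/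
theorem collect_member (u : A) (K P J : Ideal A) :
    Ideal.span {u ^ 2} * K * (Ideal.span {u ^ 2} * P * (Ideal.span {u ^ 3} * J)) =
      Ideal.span {u ^ 7} * (K * J * P) := by
  rw [← Ideal.span_singleton_pow, ← Ideal.span_singleton_pow, ← Ideal.span_singleton_pow]
  ring

end Algebra

/-! ## The member, its avatars, and their images on a Rees chart of `Bl_{(x)}` (any ring) -/

section Charts

variable {R : Type u} [CommRing R] (x : Fin 4 → R) (i : Fin 4)

/-- `M = (x)` (the maximal ideal in the application). -/
local notation3 "M" => Ideal.span (Set.range x)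
/-- The quadric `q = x₀x₁ − x₂²`. -/
local notation3 "qq" => (x 0 * x 1 - x 2 ^ 2)
/-- The member `I = (q, x₃²) + M⁴`. -/
local notation3 "II" => (Ideal.span {qq} ⊔ Ideal.span {x 3 ^ 2} ⊔ Ideal.span (Set.range x) ^ 4)
/-- The avatar of the conic `C₁`: `P₁ = (q) + x₃ M + M³`. -/
local notation3 "P₁" => (Ideal.span {qq} ⊔ Ideal.span {x 3} * Ideal.span (Set.range x) ⊔
  Ideal.span (Set.range x) ^ 3)
/-- The avatar of the surface `C₂`: `P₂ = q M + x₃² M + x₃ M³ + M⁵`. -/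
local notation3 "P₂" => (Ideal.span {qq} * Ideal.span (Set.range x) ⊔
  Ideal.span {x 3 ^ 2} * Ideal.span (Set.range x) ⊔ Ideal.span {x 3} * Ideal.span (Set.range x) ^ 3 ⊔
  Ideal.span (Set.range x) ^ 5)
/-- The chart data: `u = x_i/1`, `e_j = x_j/x_i`, `w = e₀e₁ − e₂²`. -/
local notation3 "φ" => chartBase x i
local notation3 "uu" => chartBase x i (x i)
local notation3 "e[" j "]" => chartGen x i j
local notation3 "ww" => (chartGen x i 0 * chartGen x i 1 - chartGen x i 2 ^ 2)
/-- The residuals on the chart: `K = (w) + (e₃²) + (u²)`, `J = (w) + (e₃², u e₃, u²)`, `P = (u, e₃, w)`. -/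
local notation3 "KK" => (Ideal.span {ww} ⊔ Ideal.span {e[3] ^ 2} ⊔ Ideal.span {uu ^ 2})
local notation3 "JJ" => (Ideal.span {ww} ⊔ Ideal.span {e[3] ^ 2} ⊔ Ideal.span {uu * e[3]} ⊔
  Ideal.span {uu ^ 2})
local notation3 "PP" => (Ideal.span {uu} ⊔ Ideal.span {e[3]} ⊔ Ideal.span {ww})

/-- The quadric on a chart: `φ(q) = u² · w`. [cite: StacksProject, Tag 0804] -/
theorem map_q : φ qq = uu ^ 2 * ww := by
  rw [map_sub, map_mul, map_pow, reesChartBase_apply_eq_mul_chartGen x i 0,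
    reesChartBase_apply_eq_mul_chartGen x i 1, reesChartBase_apply_eq_mul_chartGen x i 2]
  ring

/-- **The member on a chart**: `I · B_i = u² · ((w) + (e₃²) + (u²))`. [cite: StacksProject, Tag 0804] -/
theorem map_member : (II).map φ = Ideal.span {uu ^ 2} * KK := by
  rw [Ideal.map_sup, Ideal.map_sup, map_span_singleton, map_span_singleton, map_M_pow, map_q, map_pow,
    reesChartBase_apply_eq_mul_chartGen x i 3]
  have e1 : (uu * e[3]) ^ 2 = uu ^ 2 * e[3] ^ 2 := by ring
  have e2 : uu ^ 4 = uu ^ 2 * uu ^ 2 := by ring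
  rw [e1, e2, Ideal.mul_sup, Ideal.mul_sup, Ideal.span_singleton_mul_span_singleton,
    Ideal.span_singleton_mul_span_singleton, Ideal.span_singleton_mul_span_singleton]

/-- **The conic avatar on a chart**: `P₁ · B_i = u² · (u, e₃, w)`. [cite: StacksProject, Tag 0804] -/
theorem map_P₁ : (P₁).map φ = Ideal.span {uu ^ 2} * PP := by
  rw [Ideal.map_sup, Ideal.map_sup, Ideal.map_mul, map_span_singleton, map_span_singleton, map_M_pow,
    map_reesChartBase_eq (x i) (Ideal.mem_span_range_self (f := x) (x := i)), map_q,
    reesChartBase_apply_eq_mul_chartGen x i 3, Ideal.span_singleton_mul_span_singleton]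
  have e1 : uu * e[3] * uu = uu ^ 2 * e[3] := by ring
  have e2 : uu ^ 3 = uu ^ 2 * uu := by ring
  rw [e1, e2, Ideal.mul_sup, Ideal.mul_sup, Ideal.span_singleton_mul_span_singleton,
    Ideal.span_singleton_mul_span_singleton, Ideal.span_singleton_mul_span_singleton]
  -- reorder `(w, e₃, u)` to `(u, e₃, w)`
  rw [sup_comm (Ideal.span {uu ^ 2 * ww}) _, sup_comm _ (Ideal.span {uu ^ 2 * uu}), ← sup_assoc]

/-- **The surface avatar on a chart**: `P₂ · B_i = u³ · ((w) + (e₃², u e₃, u²))`.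
[cite: StacksProject, Tag 0804] -/
theorem map_P₂ : (P₂).map φ = Ideal.span {uu ^ 3} * JJ := by
  rw [Ideal.map_sup, Ideal.map_sup, Ideal.map_sup, Ideal.map_mul, Ideal.map_mul, Ideal.map_mul,
    map_span_singleton, map_span_singleton, map_span_singleton, map_M_pow, map_M_pow,
    map_reesChartBase_eq (x i) (Ideal.mem_span_range_self (f := x) (x := i)), map_q, map_pow,
    reesChartBase_apply_eq_mul_chartGen x i 3, Ideal.span_singleton_mul_span_singleton,
    Ideal.span_singleton_mul_span_singleton, Ideal.span_singleton_mul_span_singleton]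
  have e1 : uu ^ 2 * ww * uu = uu ^ 3 * ww := by ring
  have e2 : (uu * e[3]) ^ 2 * uu = uu ^ 3 * e[3] ^ 2 := by ring
  have e3 : uu * e[3] * uu ^ 3 = uu ^ 3 * (uu * e[3]) := by ring
  have e4 : uu ^ 5 = uu ^ 3 * uu ^ 2 := by ring
  rw [e1, e2, e3, e4, Ideal.mul_sup, Ideal.mul_sup, Ideal.mul_sup, Ideal.span_singleton_mul_span_singleton,
    Ideal.span_singleton_mul_span_singleton, Ideal.span_singleton_mul_span_singleton,
    Ideal.span_singleton_mul_span_singleton]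

set_option maxHeartbeats 400000 in
-- instance-path defeq through `HomogeneousLocalization`'s standalone `Pow`/`Mul` (as in p508825)
/-- **THE CHART IMAGE OF `I · P₁ · P₂`** on every Rees chart `D₊(x_i t)` of `Bl_M Spec R`:
`(I P₁ P₂) B_i = u⁷ · ((K · J) · P)`. [cite: StacksProject, Tag 0804] -/
theorem map_member_mul_Q₀ : (II * (P₁ * P₂)).map φ = Ideal.span {uu ^ 7} * ((KK * JJ) * PP) := by
  rw [Ideal.map_mul, Ideal.map_mul, map_member, map_P₁, map_P₂]
  exact collect_member _ _ _ _

/-- `P₁ P₂ ⊇ M⁸`. [folklore] -/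
theorem pow_le_Q₀ : Ideal.span (Set.range x) ^ 8 ≤ P₁ * P₂ := by
  rw [show (8 : ℕ) = 3 + 5 from rfl, pow_add]
  exact Ideal.mul_mono le_sup_right le_sup_right

end Charts

/-! ## The member over a regular local ring of embedding dimension four -/

section LocalRung

variable {S : Type u} [CommRing S] [IsRegularLocalRing S] (x : Fin 4 → S)
  (hx : Ideal.span (Set.range x) = IsLocalRing.maximalIdeal S)
  (hd : (IsLocalRing.maximalIdeal S).spanFinrank = 4)

/-- The quadric `q = x₀x₁ − x₂²`. -/
local notation3 "qq" => (x 0 * x 1 - x 2 ^ 2)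
/-- The member `I = (q, x₃²) + 𝔪⁴`. -/
local notation3 "II" => (Ideal.span {qq} ⊔ Ideal.span {x 3 ^ 2} ⊔ Ideal.span (Set.range x) ^ 4)
/-- The conic avatar. -/
local notation3 "P₁" => (Ideal.span {qq} ⊔ Ideal.span {x 3} * Ideal.span (Set.range x) ⊔
  Ideal.span (Set.range x) ^ 3)
/-- The surface avatar. -/
local notation3 "P₂" => (Ideal.span {qq} * Ideal.span (Set.range x) ⊔
  Ideal.span {x 3 ^ 2} * Ideal.span (Set.range x) ⊔ Ideal.span {x 3} * Ideal.span (Set.range x) ^ 3 ⊔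
  Ideal.span (Set.range x) ^ 5)

include hx hd in
set_option maxHeartbeats 800000 in
-- instance-path defeq through `HomogeneousLocalization`'s standalone `Mul`/`Sub`/`Pow`/`One`
/-- **Every Rees chart of `Bl_𝔪 Spec S` blown up along `(I P₁ P₂) · B_i` is regular**
(`i = 3`: the residual is `(1)`; `i ∈ {0, 1, 2}`: the conic tower with `w = e₁ − e₂²`, `e₀ − e₂²`,
`e₀e₁ − 1`). [cite: Liu2002, Thm. 8.1.19 (a)] [cite: StacksProject, Tag 080A] [cite: StacksProject, Tag 0BIQ] -/
theorem isRegular_charts (i : Fin 4) (Y : Scheme.{u}) (ρ : Y ⟶ Spec (.of (chartRing x i)))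
    (hρ : IsBlowup ρ (affineBlowup.idealSheaf ((II * (P₁ * P₂)).map (chartBase x i)))) :
    Scheme.IsRegular Y := by
  haveI : IsRegularRing S := isRegularRing_of_isRegularLocalRing S
  haveI hmax : (Ideal.span (Set.range x)).IsMaximal := hx ▸ IsLocalRing.maximalIdeal.isMaximal S
  haveI : IsRegularRing (S ⧸ Ideal.span (Set.range x)) := by
    letI := Ideal.Quotient.field (Ideal.span (Set.range x))
    infer_instance
  haveI : IsDomain (S ⧸ Ideal.span (Set.range x)) := Ideal.Quotient.isDomain _
  have hq : IsQuasiRegular x := isQuasiRegular_regularSystemOfParameters hd x hx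
  haveI hB : IsRegularRing (chartRing x i) := isRegularRing_blowupChart x i hq
  have hu : chartBase x i (x i) ∈ (chartRing x i)⁰ :=
    reesChartBase_mem_nonZeroDivisors (x i) (Ideal.mem_span_range_self (f := x) (x := i))
  have he : chartGen x i i = 1 := eq_one_of_eq_mul_self hu (reesChartBase_apply_eq_mul_chartGen x i i)
  rw [map_member_mul_Q₀] at hρ
  have hi : i = 0 ∨ i = 1 ∨ i = 2 ∨ i = 3 := by
    fin_cases i
    · exact Or.inl rfl
    · exact Or.inr (Or.inl rfl)
    · exact Or.inr (Or.inr (Or.inl rfl))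
    · exact Or.inr (Or.inr (Or.inr rfl))
  rcases hi with rfl | rfl | rfl | rfl
  · -- chart of `x₀`: `w = e₁ − e₂²`
    rw [he, one_mul_cr (A := chartRing x 0)] at hρ
    obtain ⟨hq3, hreg3⟩ := hyps_gen_sub_gen_sq x 0 ⟨1, by decide⟩ ⟨2, by decide⟩ ⟨3, by decide⟩ hq
      (by decide) (by decide) (by decide)
    refine CoreRungTower.isRegular_of_isBlowup_span_singleton_mul (pow_mem hu 7) _ (fun Y' ρ' h' => ?_) hρ
    exact conicTower_isRegular _ _ _ hq3 hreg3 h'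
  · -- chart of `x₁`: `w = e₀ − e₂²`
    rw [he, mul_one_cr (A := chartRing x 1)] at hρ
    obtain ⟨hq3, hreg3⟩ := hyps_gen_sub_gen_sq x 1 ⟨0, by decide⟩ ⟨2, by decide⟩ ⟨3, by decide⟩ hq
      (by decide) (by decide) (by decide)
    refine CoreRungTower.isRegular_of_isBlowup_span_singleton_mul (pow_mem hu 7) _ (fun Y' ρ' h' => ?_) hρ
    exact conicTower_isRegular _ _ _ hq3 hreg3 h'
  · -- chart of `x₂`: `w = e₀e₁ − 1` (the hyperbola chart)
    rw [he, one_sq_cr (A := chartRing x 2)] at hρ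
    obtain ⟨hq3, hreg3⟩ := hyps_gen_mul_gen_sub_one x 2 ⟨0, by decide⟩ ⟨1, by decide⟩ ⟨3, by decide⟩ hq
      (by decide) (by decide) (by decide)
    refine CoreRungTower.isRegular_of_isBlowup_span_singleton_mul (pow_mem hu 7) _ (fun Y' ρ' h' => ?_) hρ
    exact conicTower_isRegular _ _ _ hq3 hreg3 h'
  · -- chart of `x₃`: `e₃ = 1`, residual `(1)`
    rw [he, residual_top (A := chartRing x 3), Ideal.mul_top] at hρ
    exact isRegular_of_isBlowup_span_singleton_nzd (pow_mem hu 7) hρ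

include hx hd in
/-- **The tower is regular**: every blowing up of `Spec S` along `(I · P₁P₂) · 𝔪` is regular.
[cite: StacksProject, Tag 080A] -/
theorem isRegular_of_isBlowup_member_mul_companion {Y : Scheme.{u}} {f : Y ⟶ Spec (.of S)}
    (hf : IsBlowup f (affineBlowup.idealSheaf ((II * (P₁ * P₂)) * IsLocalRing.maximalIdeal S))) :
    Scheme.IsRegular Y := by
  rw [← hx] at hf
  exact isRegular_of_isBlowup_mul_of_charts x _ (isRegular_charts x hx hd) hf

include hx hd in
/-- **The two-quadric member is in the companion class** (W2 / r1d format; companion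
`P₁P₂ · 𝔪 ⊇ 𝔪⁹`; the member written with `𝔪⁴`). [cite: StacksProject, Tag 080A] -/
theorem companion_member :
    ∃ (Q : Ideal S) (m' : ℕ), IsLocalRing.maximalIdeal S ^ m' ≤ Q ∧
      ∃ (B : Scheme.{u}) (b : B ⟶ Spec (.of S)),
        IsBlowup b (affineBlowup.idealSheaf
          ((Ideal.span {qq} ⊔ Ideal.span {x 3 ^ 2} ⊔ IsLocalRing.maximalIdeal S ^ 4) * Q)) ∧
        Scheme.IsRegular B := by
  obtain ⟨B, b, hb⟩ := exists_isBlowup (Spec (.of S))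
    (affineBlowup.idealSheaf ((II * (P₁ * P₂)) * IsLocalRing.maximalIdeal S))
  have hII : Ideal.span {qq} ⊔ Ideal.span {x 3 ^ 2} ⊔ IsLocalRing.maximalIdeal S ^ 4 = II := by rw [hx]
  refine ⟨(P₁ * P₂) * IsLocalRing.maximalIdeal S, 9, ?_, B, b, by rwa [hII, ← mul_assoc],
    isRegular_of_isBlowup_member_mul_companion x hx hd hb⟩
  rw [pow_succ]
  exact Ideal.mul_mono (by rw [← hx]; exact pow_le_Q₀ x) le_rfl

include hx hd in
/-- **CORE RUNG — the two-quadric member.** `S` regular local of embedding dimension four,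
`x₀, …, x₃` a regular system of parameters: every blowing up `T` of `Spec S` along
`I = (x₀x₁ − x₂², x₃²) + 𝔪⁴` satisfies the conclusion of the blow-up-form open core.
[cite: StacksProject, Tag 080A] [cite: GortzWedhorn2020, Prop. 13.91 (2)] -/
theorem coreRung_member (h𝔪 : IsLocalRing.maximalIdeal S ≠ ⊥) (T : Scheme.{u}) (f : T ⟶ Spec (.of S))
    (hf : IsBlowup f (affineBlowup.idealSheaf
      (Ideal.span {qq} ⊔ Ideal.span {x 3 ^ 2} ⊔ IsLocalRing.maximalIdeal S ^ 4))) :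
    ∃ (J : T.IdealSheafData) (T' : Scheme.{u}) (π : T' ⟶ T), J ≠ ⊥ ∧
      (∀ t : T, t ∈ J.support → f.base t = IsLocalRing.closedPoint S) ∧
      IsBlowup π J ∧ Scheme.IsRegular T' := by
  rw [← hx] at hf
  have hI : II ≠ ⊥ := fun h =>
    span_sup_pow_maximalIdeal_ne_bot h𝔪 (Ideal.span {qq} ⊔ Ideal.span {x 3 ^ 2}) 4 (by rw [hx] at h; exact h)
  exact atomConclusion_of_pointBlowup_charts x hx h𝔪 hI (N := 8) (by rw [← hx]; exact pow_le_Q₀ x)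
    (isRegular_charts x hx hd) T f hf

end LocalRung

/-- **The `ringKrullDim S = 4` shape.** [cite: StacksProject, Tag 080A] [cite: Liu2002, Thm. 8.1.19 (a)] -/
theorem coreRung_member_of_ringKrullDim {S : Type u} [CommRing S] [IsRegularLocalRing S]
    (x : Fin 4 → S) (hx : Ideal.span (Set.range x) = IsLocalRing.maximalIdeal S)
    (hdim : ringKrullDim S = (4 : ℕ)) (T : Scheme.{u}) (f : T ⟶ Spec (.of S))
    (hf : IsBlowup f (affineBlowup.idealSheaf
      (Ideal.span {x 0 * x 1 - x 2 ^ 2} ⊔ Ideal.span {x 3 ^ 2} ⊔ Ideal.span (Set.range x) ^ 4))) :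
    ∃ (J : T.IdealSheafData) (T' : Scheme.{u}) (π : T' ⟶ T), J ≠ ⊥ ∧
      (∀ t : T, t ∈ J.support → f.base t = IsLocalRing.closedPoint S) ∧
      IsBlowup π J ∧ Scheme.IsRegular T' := by
  have hd : (IsLocalRing.maximalIdeal S).spanFinrank = 4 := by
    have h := IsRegularLocalRing.spanFinrank_maximalIdeal (R := S)
    rw [hdim] at h
    exact_mod_cast h
  have h𝔪 : IsLocalRing.maximalIdeal S ≠ ⊥ := fun hbot => by
    have h0 := ringKrullDim_eq_zero_of_isField (IsLocalRing.isField_iff_maximalIdeal_eq.mpr hbot)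
    rw [hdim] at h0
    exact absurd h0 (by norm_num)
  rw [hx] at hf
  exact coreRung_member x hx hd h𝔪 T f hf

/-- **The registered core's binder shape (`stub_atomDimFourBlowup`), restricted to the two-quadric
member** `I = (x₀x₁ − x₂², x₃²) + 𝔪⁴`; the characteristic, completeness, residue-field and
off-fibre hypotheses are not used (underscored). [cite: StacksProject, Tag 080A] -/
theorem atomDimFourBlowupAt_member (p : ℕ) (_hp : p.Prime) (S : Type)
    [CommRing S] [IsRegularLocalRing S] [CharP S p]
    [IsAdicComplete (IsLocalRing.maximalIdeal S) S]
    [PerfectField (IsLocalRing.ResidueField S)] (hS : ringKrullDim S = (4 : ℕ))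
    (x : Fin 4 → S) (hx : Ideal.span (Set.range x) = IsLocalRing.maximalIdeal S)
    (T : Scheme.{0}) (f : T ⟶ Spec (.of S))
    (hf : IsBlowup f (affineBlowup.idealSheaf
      (Ideal.span {x 0 * x 1 - x 2 ^ 2} ⊔ Ideal.span {x 3 ^ 2} ⊔ Ideal.span (Set.range x) ^ 4)))
    (_hoff : ∀ t : T, f.base t ≠ IsLocalRing.closedPoint S →
      IsRegularLocalRing (T.presheaf.stalk t)) :
    ∃ (J : T.IdealSheafData) (T' : Scheme.{0}) (π : T' ⟶ T), J ≠ ⊥ ∧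
      (∀ t : T, t ∈ J.support → f.base t = IsLocalRing.closedPoint S) ∧
      IsBlowup π J ∧ Scheme.IsRegular T' :=
  coreRung_member_of_ringKrullDim x hx hS T f hf

end TwoQuadric

end Summit.ResolutionOfSingularities.ResolutionOfSingularities.Theorems

end
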